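import Mathlib
import HarnessLib
import Summits.Ventures.LatticeQCDFlow.Scoring.RegenerativeEstimatorSigma
import Summits.Ventures.LatticeQCDFlow.Scoring.RegenerativeVarianceEstimatorPlugIn
import Summits.Ventures.LatticeQCDFlow.Exactness.ApproxTrivializingSampler

/-!
# Independence Metropolis with log-weight oscillation `≤ M`: the regenerative estimator at the CLT
# scale `4(e^{−M} σ²_f/s² + 1 − e^{−M})/R`, `0 ≤ σ²_f ≤ (2C)²(2e^{M} − 1)`, and a consistent variance
# estimator from the same tours

HONEST FRAMING: exact (Metropolis-corrected) sampling algorithms for lattice gauge theory;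
figures of merit are autocorrelation/cost numbers at stated couplings and volumes; no
continuum-physics claim.

Venture `LatticeQCDFlow` (cell pub-lqcd), topic `Scoring`; FANOUT row 8 (`s0-cpn-nemc`, GEN-17).
NEW WORK of the cell, not a published result; no definition is introduced.  The general-state-space
instance of GEN-17's regenerative chapter (`Scoring/RegenerativeEstimatorSigma.lean`,
`Scoring/RegenerativeVarianceEstimatorPlugIn.lean`), composed — exactly as
`Scoring/IndepMHRegenerative.lean` (GEN-16) — with the tree's
`Exactness.indepMH_exact_doeblin_of_density_ratio`: for `q = ρ · π` with `ρ > 0` measurable and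
`ρ x ≤ e^{M} ρ y`, the independence Metropolis kernel `K = indepMH q (1/ρ)` is exact for `π` and
`K(x, ·) ≥ e^{−M} π`, so every split kernel of `(K, π, e^{−M})` carries regeneration tours.  New here:
(i) the asymptotic variance `σ²_f = Var_π f + 2 Σ_{k≥1} C_f(k)` of every bounded observable satisfies
`0 ≤ σ²_f ≤ (2C)²(2 − e^{−M})/e^{−M}`; (ii) the regenerative estimator's CLT-free error bar AT THE CLT
SCALE, `P(s ≤ |Â_R − π(f)|) ≤ 4(e^{−M} σ²_f/s² + (1 − e^{−M}))/R`, any start; (iii) the plug-in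
regenerative variance estimator `V̂_R` is consistent with the explicit rate of the parent file at
`ε = e^{−M}`.  Printed counterpart NAMED ONLY: Mykland–Tierney–Yu 1995 §4.1 (regeneration for
independence chains); Hobert–Jones–Presnell–Rosenthal 2002 — nothing is cited as a fact.

## Content (`π`, `q = ρ·π`, `M > 0`; `K = indepMH q (1/ρ)`; `κ̂` a split kernel of `(K, π, e^{−M})`;
## `|f| ≤ C`; tours `1..R` from any start; `σ²_f` as displayed)

* **`indepMH_asymptoticVariance_bounds`** — `0 ≤ σ²_f ≤ (2C)²(2 − e^{−M})/e^{−M}`;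
* **`indepMH_regenerative_confidence_sigma`** — `P(s ≤ |Â_R − π(f)|) ≤ 4(e^{−M} σ²_f/s² + (1 − e^{−M}))/R`;
* **`indepMH_variance_plugIn_confidence`** — `P(a + 3(4Cs + s²)/e^{−2M} ≤ |V̂_R − v|) ≤
  ((2C)⁴·24/(e^{−4M} a²) + 24 + 4((2 − e^{−M})(2C)²/s² + (1 − e^{−M})))/R`.

NOT CLAIMED: any `M` for a concrete proposal; optimal constants; the realisation of the coins.
-/

noncomputable section

namespace Summit.Ventures.LatticeQCDFlow.Scoring

open MeasureTheory ProbabilityTheory Filter Finset Summit.Ventures.LatticeQCDFlow.Exactness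
open Literature.Probability.MarkovChains
open scoped ENNReal

variable {Ω : Type*} [MeasurableSpace Ω]

/-- **The asymptotic variance of an independence Metropolis sampler with log-weight oscillation
`≤ M`**: for every bounded measurable `f`, `0 ≤ σ²_f ≤ (2C)² (2 − e^{−M})/e^{−M}`. -/
theorem indepMH_asymptoticVariance_bounds {π q : Measure Ω} [IsProbabilityMeasure π]
    [IsProbabilityMeasure q] {ρ : Ω → ℝ} (hρm : Measurable ρ) (hρ0 : ∀ x, 0 < ρ x)
    (hq : q = π.withDensity fun x => ENNReal.ofReal (ρ x)) {M : ℝ} (hM0 : 0 < M)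
    (hM : ∀ x y, ρ x ≤ Real.exp M * ρ y) {f : Ω → ℝ} (hf : Measurable f) {C : ℝ}
    (hC : ∀ x, |f x| ≤ C) :
    haveI : Fact (Measurable fun x => (ρ x)⁻¹) := ⟨hρm.inv⟩
    0 ≤ (∫ y, (f y - ∫ z, f z ∂π) ^ 2 ∂π) + 2 * ∑' k, ∫ y, (f y - ∫ z, f z ∂π)
          * (kop (indepMH q fun x => (ρ x)⁻¹))^[k + 1] (fun y => f y - ∫ z, f z ∂π) y ∂π
    ∧ (∫ y, (f y - ∫ z, f z ∂π) ^ 2 ∂π) + 2 * ∑' k, ∫ y, (f y - ∫ z, f z ∂π)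
          * (kop (indepMH q fun x => (ρ x)⁻¹))^[k + 1] (fun y => f y - ∫ z, f z ∂π) y ∂π
      ≤ (2 * C) ^ 2 * (2 - Real.exp (-M)) / Real.exp (-M) := by
  haveI : Fact (Measurable fun x => (ρ x)⁻¹) := ⟨hρm.inv⟩
  obtain ⟨hinv, -, hdoeb⟩ := indepMH_exact_doeblin_of_density_ratio hρm hρ0 hq hM
  have hε0 : 0 < ENNReal.ofReal (Real.exp (-M)) := ENNReal.ofReal_pos.2 (Real.exp_pos _)
  have hε1 : ENNReal.ofReal (Real.exp (-M)) < 1 := by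
    rw [ENNReal.ofReal_lt_one]
    exact Real.exp_lt_one_iff.2 (by linarith)
  have hr : (ENNReal.ofReal (Real.exp (-M))).toReal = Real.exp (-M) :=
    ENNReal.toReal_ofReal (Real.exp_pos _).le
  refine ⟨asymptoticVariance_nonneg_minorised (κ := indepMH q fun x => (ρ x)⁻¹) (ν := π) hinv
    (fun x _ hB => hdoeb x hB) hε0 hε1 hf hC, ?_⟩
  have h := asymptoticVariance_le_minorised (κ := indepMH q fun x => (ρ x)⁻¹) (ν := π) hinv
    (fun x _ hB => hdoeb x hB) hε0 hε1 hf hC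
  rw [hr] at h
  exact h

/-- **The regenerative estimator of an independence Metropolis run, AT THE CLT SCALE**:
`P(s ≤ |Â_R − π(f)|) ≤ 4 (e^{−M} σ²_f / s² + (1 − e^{−M})) / R`, any start. -/
theorem indepMH_regenerative_confidence_sigma {π q : Measure Ω} [IsProbabilityMeasure π]
    [IsProbabilityMeasure q] {ρ : Ω → ℝ} (hρm : Measurable ρ) (hρ0 : ∀ x, 0 < ρ x)
    (hq : q = π.withDensity fun x => ENNReal.ofReal (ρ x)) {M : ℝ} (hM0 : 0 < M)
    (hM : ∀ x y, ρ x ≤ Real.exp M * ρ y)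
    (κs : Kernel (Ω × Bool) (Ω × Bool)) [IsMarkovKernel κs]
    (hκs : haveI : Fact (Measurable fun x => (ρ x)⁻¹) := ⟨hρm.inv⟩
      ∀ p, κs p = (ENNReal.ofReal (Real.exp (-M)) • π).map (fun y : Ω => (y, true))
        + ((1 - ENNReal.ofReal (Real.exp (-M))) • Doeblin.residualKernel
            (indepMH q fun x => (ρ x)⁻¹) π (ENNReal.ofReal (Real.exp (-M)))
            (fun x _ hB => (indepMH_exact_doeblin_of_density_ratio hρm hρ0 hq hM).2.2 x hB) p.1).map
          (fun y : Ω => (y, false)))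
    (μs : Measure (Ω × Bool)) [IsProbabilityMeasure μs]
    {f : Ω → ℝ} (hf : Measurable f) {C : ℝ} (hC : ∀ x, |f x| ≤ C) {R : ℕ} (hR : 0 < R)
    {s : ℝ} (hs : 0 < s) :
    haveI : Fact (Measurable fun x => (ρ x)⁻¹) := ⟨hρm.inv⟩
    (Kernel.trajMeasure (X := fun _ : ℕ => Ω × Bool) μs
        (fun n : ℕ => κs.comap (fun h : (i : ↥(Finset.Iic n)) → Ω × Bool =>
          h ⟨n, Finset.mem_Iic.2 le_rfl⟩) (measurable_pi_apply _))).real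
      {x | s ≤ |(∑ i ∈ Finset.range R, ∑' u, (if (∑ s ∈ Finset.range u,
            (if (x (s + 1)).2 then (1 : ℕ) else 0)) = i + 1 then (1 : ℝ) else 0) * f (x u).1)
          / (∑ i ∈ Finset.range R, ∑' u, (if (∑ s ∈ Finset.range u,
            (if (x (s + 1)).2 then (1 : ℕ) else 0)) = i + 1 then (1 : ℝ) else 0))
          - ∫ z, f z ∂π|}
      ≤ 4 * (Real.exp (-M) * ((∫ y, (f y - ∫ z, f z ∂π) ^ 2 ∂π)
          + 2 * ∑' k, ∫ y, (f y - ∫ z, f z ∂π)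
            * (kop (indepMH q fun x => (ρ x)⁻¹))^[k + 1] (fun y => f y - ∫ z, f z ∂π) y ∂π)
          / s ^ 2 + (1 - Real.exp (-M))) / R := by
  haveI : Fact (Measurable fun x => (ρ x)⁻¹) := ⟨hρm.inv⟩
  obtain ⟨hinv, -, hdoeb⟩ := indepMH_exact_doeblin_of_density_ratio hρm hρ0 hq hM
  have hε0 : 0 < ENNReal.ofReal (Real.exp (-M)) := ENNReal.ofReal_pos.2 (Real.exp_pos _)
  have hε1 : ENNReal.ofReal (Real.exp (-M)) < 1 := by
    rw [ENNReal.ofReal_lt_one]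
    exact Real.exp_lt_one_iff.2 (by linarith)
  have hr : (ENNReal.ofReal (Real.exp (-M))).toReal = Real.exp (-M) :=
    ENNReal.toReal_ofReal (Real.exp_pos _).le
  have h := regenerative_estimator_confidence_sigma κs μs (κ := indepMH q fun x => (ρ x)⁻¹)
    (ν := π) (hmin := fun x _ hB => hdoeb x hB) hinv hε0 hε1 hκs hf hC hR hs
  rw [hr] at h
  exact h

/-- **The plug-in regenerative variance estimator of an independence Metropolis run is consistent**
(explicit CLT-free rate at `ε = e^{−M}`, any start). -/
theorem indepMH_variance_plugIn_confidence {π q : Measure Ω} [IsProbabilityMeasure π]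
    [IsProbabilityMeasure q] {ρ : Ω → ℝ} (hρm : Measurable ρ) (hρ0 : ∀ x, 0 < ρ x)
    (hq : q = π.withDensity fun x => ENNReal.ofReal (ρ x)) {M : ℝ} (hM0 : 0 < M)
    (hM : ∀ x y, ρ x ≤ Real.exp M * ρ y)
    (κs : Kernel (Ω × Bool) (Ω × Bool)) [IsMarkovKernel κs]
    (hκs : haveI : Fact (Measurable fun x => (ρ x)⁻¹) := ⟨hρm.inv⟩
      ∀ p, κs p = (ENNReal.ofReal (Real.exp (-M)) • π).map (fun y : Ω => (y, true))
        + ((1 - ENNReal.ofReal (Real.exp (-M))) • Doeblin.residualKernel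
            (indepMH q fun x => (ρ x)⁻¹) π (ENNReal.ofReal (Real.exp (-M)))
            (fun x _ hB => (indepMH_exact_doeblin_of_density_ratio hρm hρ0 hq hM).2.2 x hB) p.1).map
          (fun y : Ω => (y, false)))
    (μs : Measure (Ω × Bool)) [IsProbabilityMeasure μs]
    {f : Ω → ℝ} (hf : Measurable f) {C : ℝ} (hC : ∀ x, |f x| ≤ C) {R : ℕ} (hR : 0 < R)
    {a : ℝ} (ha : 0 < a) {s : ℝ} (hs : 0 < s) :
    haveI : Fact (Measurable fun x => (ρ x)⁻¹) := ⟨hρm.inv⟩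
    (Kernel.trajMeasure (X := fun _ : ℕ => Ω × Bool) μs
        (fun n : ℕ => κs.comap (fun h : (i : ↥(Finset.Iic n)) → Ω × Bool =>
          h ⟨n, Finset.mem_Iic.2 le_rfl⟩) (measurable_pi_apply _))).real
      {x | a + 3 * (4 * C * s + s ^ 2) / Real.exp (-M) ^ 2
        ≤ |(∑ i ∈ Finset.range R, ((∑' u, (if (∑ s ∈ Finset.range u,
              (if (x (s + 1)).2 then (1 : ℕ) else 0)) = i + 1 then (1 : ℝ) else 0) * f (x u).1)
            - ((∑ i ∈ Finset.range R, ∑' u, (if (∑ s ∈ Finset.range u,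
                (if (x (s + 1)).2 then (1 : ℕ) else 0)) = i + 1 then (1 : ℝ) else 0) * f (x u).1)
              / (∑ i ∈ Finset.range R, ∑' u, (if (∑ s ∈ Finset.range u,
                (if (x (s + 1)).2 then (1 : ℕ) else 0)) = i + 1 then (1 : ℝ) else 0)))
            * (∑' u, (if (∑ s ∈ Finset.range u, (if (x (s + 1)).2 then (1 : ℕ) else 0)) = i + 1
              then (1 : ℝ) else 0))) ^ 2) / R
          - ∫ y, (∑' u, (if (∑ s ∈ Finset.range u, (if (y (s + 1)).2 then (1 : ℕ) else 0)) = 0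
            then (1 : ℝ) else 0) * (f (y u).1 - ∫ z, f z ∂π)) ^ 2
            ∂(Kernel.trajMeasure (X := fun _ : ℕ => Ω × Bool) (π.map (fun y : Ω => (y, true)))
              (fun n : ℕ => κs.comap (fun h : (i : ↥(Finset.Iic n)) → Ω × Bool =>
                h ⟨n, Finset.mem_Iic.2 le_rfl⟩) (measurable_pi_apply _)))|}
      ≤ ((2 * C) ^ 4 * 24 / (Real.exp (-M) ^ 4 * a ^ 2) + 24
          + 4 * ((2 - Real.exp (-M)) * (2 * C) ^ 2 / s ^ 2 + (1 - Real.exp (-M)))) / R := by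
  haveI : Fact (Measurable fun x => (ρ x)⁻¹) := ⟨hρm.inv⟩
  obtain ⟨hinv, -, hdoeb⟩ := indepMH_exact_doeblin_of_density_ratio hρm hρ0 hq hM
  have hε0 : 0 < ENNReal.ofReal (Real.exp (-M)) := ENNReal.ofReal_pos.2 (Real.exp_pos _)
  have hε1 : ENNReal.ofReal (Real.exp (-M)) < 1 := by
    rw [ENNReal.ofReal_lt_one]
    exact Real.exp_lt_one_iff.2 (by linarith)
  have hr : (ENNReal.ofReal (Real.exp (-M))).toReal = Real.exp (-M) :=
    ENNReal.toReal_ofReal (Real.exp_pos _).le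
  have h := regenerative_variance_plugIn_confidence κs μs (κ := indepMH q fun x => (ρ x)⁻¹)
    (ν := π) (hmin := fun x _ hB => hdoeb x hB) hinv hε0 hε1 hκs hf hC hR ha hs
  rw [hr] at h
  exact h

end Summit.Ventures.LatticeQCDFlow.Scoring

end
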